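import Summits.BirchSwinnertonDyer.Rank1Residual.X11a.SelmerCompanionAuxiliary
import Summits.BirchSwinnertonDyer.Rank1Residual.X11a.SelmerCompanionTateLineShape
import HarnessLib

/-!
# Route (3e) SELMER COMPANION, XXXVIII: SHAPE F at a FULL-TORSION level-lowering place — the
# auxiliary curve with the Tate-line certificates of shape G (class X11a = N7; cell `b2b-bsdres`,
# unit `b2b-bsdres-x11a`, gen 32)

HONEST FRAMING (run/shared/lean/b2b/bsd-rank1-residual/, verbatim in every file): the goal of the
cell is to DELETE the COMBINATION-SHAPED residual classes of the Birch–Swinnerton-Dyer formula for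
ALL analytic-rank `≤ 1` elliptic curves over `ℚ` — "full BSD formula for every rank `≤ 1` curve in
class `C`" assembled STRICTLY from published theorems — so that the rank-`≤ 1` remainder becomes
exactly the CONSTRUCTION-SHAPED classes, which are TYPED (missing-input `Prop`s), NOT attempted.
This is not "finishing BSD". CLASS-OWNERS.md: research routes; NO CLAIM BEYOND STATED CLASSES.
THEOREMS ONLY; nothing booked; no label moves. CONDITIONAL on the PUBLISHED binders GZK (`hGZK`),
Cassels–Tate (`hCT`), Tate uniformisation (`hU2` = A41; the Tate datum of `E` at `v₀` = A40 enters
as the explicit hypotheses `Φ'`, `hequiv'`, `hrat'`), Tate's local Euler characteristic (`hEP`,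
Milne *ADT* I Thm. 2.8), and on the per-pair finite data named.

## What this file proves

Files XXXVI/XXXVII (SHAPE F) decide a two-loss class-(A) cell with an auxiliary curve `F` when the
level-lowering loss sits at a place `ℓ₀` with `#E(ℚ_{ℓ₀})[p] = p`. When `E` has FULL `p`-torsion
over `ℚ_{ℓ₀}` (`ℓ₀ ≡ 1 (mod p)`, census v10 cells 180048j1/m1, 291648in1, 140946s1 @3, 118080ds1 @5)
the kill lemma of file XIV does not apply; instead the place is of shape G (files XXXII–XXXV:
index `≤ p` by lemma G1, strictness by the `δ`-certificate). This file runs SHAPE G with the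
closed rank-one partner REPLACED by the auxiliary curve:

* `not_zsmul_of_tateLine_certificate` — the `δ`-certificate of file XXXII for a rational point
  `g ∈ F(ℚ)` (no `p`-th root `c` of `g_{v₀}` in `F(K̄_{v₀})` has all `σc − c` on the transported Tate
  line `Λ`) implies `g_{v₀} ∉ p·F(ℚ_{v₀})` (`0 ∈ Λ`; a `ℚ_{v₀}`-rational root is `Γ`-fixed);
* `bsdp_of_auxiliary_of_tateLine_certificates` — **SHAPE F at a Tate-line place**: `E = W` rank
  `0`, `E[p]` irreducible, `p ∤ #Ш_an(E)`, `p` odd; `A₀` globally minimal CLOSED at `p`,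
  `r_an(A₀) = 0`, `p ∤ #Ш_an(A₀)`, `A₀[p]` irreducible, GOOD at `p`; `F` globally minimal,
  MULTIPLICATIVE at `p`; `θ : E[p] ≃ F[p]`, `θ₀ : F[p] ≃ A₀[p]` equivariant; `hagree₁` (`E ~ F` off
  `T₁ ∪ {v₀}`), `hagree₂` (`F ~ A₀` off `T₂ ∪ {v_p}`); budgets `p·∏_{T₁} ≤ p`, `p·∏_{T₂} ≤ p`; at
  `v₀ ∤ p`: the equivariant Tate datum `Φ'` of `E` (A40), `p ∣ q_{v₀} − 1`, a Kummer point along the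
  transported line (`hpt`, lemma G1) and the `δ`-certificate (`hcert`) for a rational point
  `g ∈ F(ℚ)`. Then `BSD(E,p)`. PROOF: `#Sel^(p)(F) ≤ p` (file XXVII against `A₀`, strictness
  vacuous), `g_{v₀} ∉ p·F(ℚ_{v₀})` so `κ(g)` restricts non-trivially (file XXII) and
  `#Sel^(p)(F) = p` (file XXXVI); then the assembly of file XXXV verbatim (file XX's count with
  `m = p` from G1 and the strictness of file XXXII; Cassels–Tate + GZK).

Not a class theorem; nothing booked. References: [MazurRubin2004] §2.3; [Miller2011LMS] Def. 1.1;
[MilneADT2006] I Thm. 2.8; [SilvermanATAEC1994] V.3.1, V.5.3, IV Rem. 9.6; files II, XX, XXII,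
XXVII, XXXII–XXXVI; HOME/b2b-bsdres-x11a/REPORT-g32.md.
-/

set_option autoImplicit false

noncomputable section

open scoped Classical NNReal

open WeierstrassCurve Literature.NumberTheory.EllipticCurves
  Literature.NumberTheory.GaloisRepresentations Field NumberField IsDedekindDomain
  IsDedekindDomain.HeightOneSpectrum
  Literature.NumberTheory.EllipticCurves.Rank1Residual
  Literature.NumberTheory.EllipticCurves.Rank1Residual.Typed

namespace Summit.BirchSwinnertonDyer.Rank1Residual.X11a.SelmerCompanion

variable (W F A₀ : WeierstrassCurve ℚ) [W.IsElliptic] [F.IsElliptic] [F.IsGloballyMinimal]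
  [A₀.IsElliptic] [A₀.IsGloballyMinimal] (p : ℕ) [hp : Fact p.Prime]

omit [F.IsElliptic] [F.IsGloballyMinimal] hp in
/-- **The `δ`-certificate implies `g ∉ p·F(ℚ_v)`.** If no `p`-th root `c ∈ F(K̄_v)` of the image
of the rational point `g` has all `σc − c` on the transported Tate line
`Λ = {θΦ'(ζ) : ζ^p = 1}` (the hypothesis `hcert` of file XXXII), then `g` is not `p` times a
`ℚ_v`-rational point of `F`: such a point read in `F(K̄_v)` is `Γ_{ℚ_v}`-fixed (`smul_toGeomPoints`),
so all `σc − c = 0 = θΦ'(1) ∈ Λ`. [cite: SilvermanAEC2009, VIII.§2] -/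
theorem not_zsmul_of_tateLine_certificate {v : HeightOneSpectrum (𝓞 ℚ)} (hn : (p : ℤ) ≠ 0)
    (θ : geomTorsion W (p : ℤ) ≃+ geomTorsion F (p : ℤ))
    (Φ' : Additive (AlgebraicClosure (v.adicCompletion ℚ))ˣ →+ localPoints W (v.adicCompletion ℚ))
    (g : F.toAffine.Point)
    (hcert : ∀ c : localPoints F (v.adicCompletion ℚ),
      (p : ℤ) • c = pointsMap F (v.adicCompletion ℚ) (toGeomPoints F g) →
      ∃ σ : absoluteGaloisGroup (v.adicCompletion ℚ),
        ∀ (ζ : (AlgebraicClosure (v.adicCompletion ℚ))ˣ), ζ ^ p = 1 →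
        ∀ hζ : Φ' (Additive.ofMul ζ) ∈
            AddSubgroup.torsionBy (localPoints W (v.adicCompletion ℚ)) (p : ℤ),
          σ • c - c ≠ pointsMap F (v.adicCompletion ℚ)
            ((θ ((W.torsionPointsEquiv (p : ℤ) (E := v.adicCompletion ℚ) hn).symm
              ⟨Φ' (Additive.ofMul ζ), hζ⟩) : geomTorsion F (p : ℤ)) : geomPoints F)) :
    ∀ R : (F.baseChange (v.adicCompletion ℚ)).toAffine.Point,
      Affine.Point.baseChange (W' := F) ℚ (v.adicCompletion ℚ) g ≠ (p : ℤ) • R := by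
  intro R hR
  -- `R` read in `F(K̄_v)`, `Γ_{ℚ_v}`-fixed, a `p`-th root of `g`
  set c : localPoints F (v.adicCompletion ℚ) :=
    F.baseChangeGeomPointsEquiv (v.adicCompletion ℚ)
      (toGeomPoints (F.baseChange (v.adicCompletion ℚ)) R) with hcdef
  have hcfix : ∀ σ : absoluteGaloisGroup (v.adicCompletion ℚ), σ • c = c := fun σ ↦ by
    rw [hcdef, ← baseChangeGeomPointsEquiv_smul, smul_toGeomPoints]
  have hgc : (p : ℤ) • c = pointsMap F (v.adicCompletion ℚ) (toGeomPoints F g) := by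
    rw [hcdef, ← map_zsmul, ← map_zsmul, ← hR]
    exact X11b.KummerIndex.baseChangeGeomPointsEquiv_toGeomPoints_baseChange F
      (v.adicCompletion ℚ) g
  obtain ⟨σ, hσ⟩ := hcert c hgc
  have hζ : Φ' (Additive.ofMul 1) ∈
      AddSubgroup.torsionBy (localPoints W (v.adicCompletion ℚ)) (p : ℤ) := by
    rw [ofMul_one, map_zero]; exact zero_mem _
  have h0 : (⟨Φ' (Additive.ofMul 1), hζ⟩ :
      AddSubgroup.torsionBy (localPoints W (v.adicCompletion ℚ)) (p : ℤ)) = 0 :=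
    Subtype.ext (show Φ' (Additive.ofMul 1) =
      ((0 : AddSubgroup.torsionBy (localPoints W (v.adicCompletion ℚ)) (p : ℤ)) :
        localPoints W (v.adicCompletion ℚ)) by rw [ofMul_one, map_zero]; rfl)
  apply hσ 1 (one_pow p) hζ
  rw [hcfix σ, sub_self, h0, map_zero, map_zero, ZeroMemClass.coe_zero, map_zero]

/-- **SHAPE F at a FULL-TORSION level-lowering place (shape G with the auxiliary curve).** See the
module docstring. Hypotheses at `v₀ ∤ p`: the equivariant Tate datum `Φ'` of `E` (A40 content),
`hq : p ∣ q_{v₀} − 1` (so `μ_p ⊂ ℚ_{v₀}`, file XXXV), the Kummer point `hpt` of lemma G1 and the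
`δ`-certificate `hcert` of file XXXII for a rational point `g ∈ F(ℚ)`; abstract agreement off
`T₁ ∪ {v₀}` (`E ~ F`) and off `T₂ ∪ {v_p}` (`F ~ A₀`); budgets `p·∏_{T₁} ≤ p`, `p·∏_{T₂} ≤ p`.
Then `BSD(E,p)`. Binders GZK, Cassels–Tate, A41, Milne I.2.8 (at `v₀` and at `p`), A40 as data.
Not a class theorem; nothing booked.
[cite: MazurRubin2004, §2.3] [cite: Miller2011LMS, §1 and Def. 1.1]
[cite: MilneADT2006, Ch. I §2 Thm. 2.8] [cite: SilvermanATAEC1994, Ch. V Thm. 3.1, Thm. 5.3]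
[cite: GreenbergLNM1716, §2 Props. 2.2, 2.4] -/
theorem bsdp_of_auxiliary_of_tateLine_certificates
    (hU2 : Silverman1994_thmV53_corV54_tateUniformisation.{0})
    (hEP : ∀ v : HeightOneSpectrum (𝓞 ℚ), (p : 𝓞 ℚ) ∈ v.asIdeal →
      localEulerPoincareCharacteristic (v.adicCompletion ℚ))
    (hGZK : rank_eq_analyticRank_of_analyticRank_le_one)
    (hCT : exists_casselsTate_pairing (K := ℚ)) (hp2 : p ≠ 2)
    (hr : W.analyticRank = 0) (hirr : Irr W p) (hSha : X11a.ShaAnUnit W p)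
    (hbsdA : BSDp A₀ p) (hrA : A₀.analyticRank = 0) (hirrA : Irr A₀ p) (hShaA : X11a.ShaAnUnit A₀ p)
    (hA₀p : A₀.HasGoodReductionAtPrime p) (hFp : F.HasMultiplicativeReductionAtPrime p)
    (hn : (p : ℤ) ≠ 0)
    (θ : geomTorsion W (p : ℤ) ≃+ geomTorsion F (p : ℤ))
    (hθ : ∀ (σ : absoluteGaloisGroup ℚ) (P : geomTorsion W (p : ℤ)), θ (σ • P) = σ • θ P)
    (θ₀ : geomTorsion F (p : ℤ) ≃+ geomTorsion A₀ (p : ℤ))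
    (hθ₀ : ∀ (σ : absoluteGaloisGroup ℚ) (P : geomTorsion F (p : ℤ)), θ₀ (σ • P) = σ • θ₀ P)
    -- the pair (E, F)
    (S₁ T₁ : Finset (HeightOneSpectrum (𝓞 ℚ))) (hTS₁ : T₁ ⊆ S₁)
    (hS₁ : ∀ v : HeightOneSpectrum (𝓞 ℚ), v ∉ S₁ →
      F.HasGoodReductionAt v ∧ W.HasGoodReductionAt v ∧ (p : 𝓞 ℚ) ∉ v.asIdeal)
    {v₀ : HeightOneSpectrum (𝓞 ℚ)} (hpv₀ : (p : 𝓞 ℚ) ∉ v₀.asIdeal) (hv₀S : v₀ ∈ S₁) (hv₀T : v₀ ∉ T₁)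
    (hEP₀ : localEulerPoincareCharacteristic (v₀.adicCompletion ℚ))
    (hagree₁ : ∀ v ∈ S₁, v ∉ T₁ → v ≠ v₀ →
      ((p : 𝓞 ℚ) ∉ v.asIdeal ∧ Nat.card (nsmulAddMonoidHom p :
          (W.baseChange (v.adicCompletion ℚ)).toAffine.Point →+ _).ker = 1) ∨
      (∀ c ∈ selmerLocalKer W (v.adicCompletion ℚ) (p : ℤ),
        h1Equiv θ hθ c ∈ selmerLocalKer F (v.adicCompletion ℚ) (p : ℤ)))
    (Φ' : Additive (AlgebraicClosure (v₀.adicCompletion ℚ))ˣ →+ localPoints W (v₀.adicCompletion ℚ))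
    (hequiv' : ∀ (σ : absoluteGaloisGroup (v₀.adicCompletion ℚ))
        (u : (AlgebraicClosure (v₀.adicCompletion ℚ))ˣ),
      σ • Φ' (Additive.ofMul u) = Φ' (Additive.ofMul (Units.map
        (absoluteGaloisGroup.toAlgEquiv _ σ : AlgebraicClosure (v₀.adicCompletion ℚ) →*
          AlgebraicClosure (v₀.adicCompletion ℚ)) u)))
    (hrat' : ∀ P : localPoints W (v₀.adicCompletion ℚ),
      (∀ σ : absoluteGaloisGroup (v₀.adicCompletion ℚ), σ • P = P) →
      ∃ u : (v₀.adicCompletion ℚ)ˣ, Φ' (Additive.ofMul (Units.map (algebraMap (v₀.adicCompletion ℚ)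
        (AlgebraicClosure (v₀.adicCompletion ℚ)) : v₀.adicCompletion ℚ →*
          AlgebraicClosure (v₀.adicCompletion ℚ)) u)) = P)
    (hq : p ∣ Nat.card (IsLocalRing.ResidueField (v₀.adicCompletionIntegers ℚ)) - 1)
    (hpt : ∃ h : localPoints F (v₀.adicCompletion ℚ),
      (∀ σ : absoluteGaloisGroup (v₀.adicCompletion ℚ),
        ∃ (ζ : (AlgebraicClosure (v₀.adicCompletion ℚ))ˣ) (_ : ζ ^ p = 1)
          (hζ : Φ' (Additive.ofMul ζ) ∈
            AddSubgroup.torsionBy (localPoints W (v₀.adicCompletion ℚ)) (p : ℤ)),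
          σ • h - h = pointsMap F (v₀.adicCompletion ℚ)
            ((θ ((W.torsionPointsEquiv (p : ℤ) (E := v₀.adicCompletion ℚ) hn).symm
              ⟨Φ' (Additive.ofMul ζ), hζ⟩) : geomTorsion F (p : ℤ)) : geomPoints F)) ∧
      ∃ σ₁ : absoluteGaloisGroup (v₀.adicCompletion ℚ), σ₁ • h ≠ h)
    (hbudget₁ : p * ∏ v ∈ T₁, (Nat.card (nsmulAddMonoidHom p :
        (W.baseChange (v.adicCompletion ℚ)).toAffine.Point →+ _).ker *
          Nat.card (v.adicCompletionIntegers ℚ ⧸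
            Ideal.span {(p : v.adicCompletionIntegers ℚ)})) ≤ p)
    -- the pair (F, A₀)
    (S₂ T₂ : Finset (HeightOneSpectrum (𝓞 ℚ))) (hTS₂ : T₂ ⊆ S₂)
    (hS₂ : ∀ v : HeightOneSpectrum (𝓞 ℚ), v ∉ S₂ →
      A₀.HasGoodReductionAt v ∧ F.HasGoodReductionAt v ∧ (p : 𝓞 ℚ) ∉ v.asIdeal)
    {v₁ : HeightOneSpectrum (𝓞 ℚ)} (hpv₁ : (p : 𝓞 ℚ) ∈ v₁.asIdeal) (hv₁S : v₁ ∈ S₂) (hv₁T : v₁ ∉ T₂)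
    (hagree₂ : ∀ v ∈ S₂, v ∉ T₂ → v ≠ v₁ →
      ((p : 𝓞 ℚ) ∉ v.asIdeal ∧ Nat.card (nsmulAddMonoidHom p :
          (F.baseChange (v.adicCompletion ℚ)).toAffine.Point →+ _).ker = 1) ∨
      (∀ c ∈ selmerLocalKer F (v.adicCompletion ℚ) (p : ℤ),
        h1Equiv θ₀ hθ₀ c ∈ selmerLocalKer A₀ (v.adicCompletion ℚ) (p : ℤ)))
    (hbudget₂ : p * ∏ v ∈ T₂, (Nat.card (nsmulAddMonoidHom p :
        (F.baseChange (v.adicCompletion ℚ)).toAffine.Point →+ _).ker *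
          Nat.card (v.adicCompletionIntegers ℚ ⧸
            Ideal.span {(p : v.adicCompletionIntegers ℚ)})) ≤ p)
    -- the δ-certificate for a rational point of F at v₀
    (g : F.toAffine.Point)
    (hcert : ∀ c : localPoints F (v₀.adicCompletion ℚ),
      (p : ℤ) • c = pointsMap F (v₀.adicCompletion ℚ) (toGeomPoints F g) →
      ∃ σ : absoluteGaloisGroup (v₀.adicCompletion ℚ),
        ∀ (ζ : (AlgebraicClosure (v₀.adicCompletion ℚ))ˣ), ζ ^ p = 1 →
        ∀ hζ : Φ' (Additive.ofMul ζ) ∈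
            AddSubgroup.torsionBy (localPoints W (v₀.adicCompletion ℚ)) (p : ℤ),
          σ • c - c ≠ pointsMap F (v₀.adicCompletion ℚ)
            ((θ ((W.torsionPointsEquiv (p : ℤ) (E := v₀.adicCompletion ℚ) hn).symm
              ⟨Φ' (Additive.ofMul ζ), hζ⟩) : geomTorsion F (p : ℤ)) : geomPoints F)) :
    BSDp W p := by
  have hpp : p.Prime := hp.out
  classical
  -- (1) the closed rank-0 partner: `Sel^(p)(A₀) = 0`
  have hSel₀ : Nat.card (A₀.selmerGroup (p : ℤ)) = 1 := by
    rw [natCard_selmerGroup_eq_pow_of_bsdp A₀ p hbsdA hShaA hirrA, hrA, pow_zero]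
  haveI : Finite (A₀.selmerGroup (p : ℤ)) := A₀.finite_selmerGroup_holds hn
  have hsub₀ : ∀ d ∈ A₀.selmerGroup (p : ℤ), d = 0 := by
    intro d hd
    have h1 := (Nat.card_eq_one_iff_unique.mp hSel₀).1
    have h := @Subsingleton.elim _ h1 (⟨d, hd⟩ : A₀.selmerGroup (p : ℤ)) ⟨0, zero_mem _⟩
    exact congrArg Subtype.val h
  -- (2) `#Sel^(p)(F) ≤ p` against `A₀`
  obtain ⟨w₁, hw₁⟩ := v₁.exists_spectralValuation (K := ℚ)
  haveI hV₁ : (A₀.baseChange (AlgebraicClosure (v₁.adicCompletion ℚ))).IsIntegral w₁.integer :=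
    ⟨⟨(integralModelInt A₀).map (algebraMap ℤ ↥w₁.integer),
      A₀.baseChange_eq_localIntModel_integer_baseChange⟩⟩
  have hleF : Nat.card (F.selmerGroup (p : ℤ)) ≤ p :=
    (natCard_selmerGroup_le_of_agree_strict_at_p_rat F A₀ p hU2 hEP hp2 θ₀ hθ₀ S₂ T₂ hTS₂ hS₂ hpv₁
      hv₁S hv₁T hFp hA₀p hagree₂ hw₁ (fun ψ hψ _ _ _ ↦ hsub₀ _ hψ)).trans hbudget₂
  -- (3) `κ(g) ∈ Sel^(p)(F)` restricts non-trivially at `v₀` (the δ-certificate gives `g ∉ p·F(ℚ_{v₀})`)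
  have hdiv : ∀ P : geomPoints F, ∃ Q : geomPoints F, (p : ℤ) • Q = P :=
    fun P ↦ F.zsmul_geomPoints_surjective_of_charZero hn P
  have hs' : kummerMapTorsion F (p : ℤ) hdiv g ∈ F.selmerGroup (p : ℤ) :=
    (mem_selmerGroup_iff F _ _).mpr
      ⟨fun v ↦ kummerMapTorsion_mem_selmerLocalKer F (p : ℤ) hdiv (v.adicCompletion ℚ) g,
        fun w' ↦ kummerMapTorsion_mem_selmerLocalKer F (p : ℤ) hdiv w'.Completion g⟩
  have hnz := not_zsmul_of_tateLine_certificate W F p hn θ Φ' g hcert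
  have hres := res_kummerMapTorsion_ne_zero_of_not_zsmul F p (v₀.adicCompletion ℚ)
    (charZero_adicCompletion v₀) hdiv g hnz
  have hSel : Nat.card (F.selmerGroup (p : ℤ)) = p :=
    natCard_selmerGroup_eq_prime_of_le F p hleF hs' (fun h0 ↦ hres (by rw [h0]; exact map_zero _))
  have hs : kummerClassTorsion F (p : ℤ) (zsmulRoot F (p : ℤ) hdiv g)
      (zsmul_zsmulRoot_mem F (p : ℤ) hdiv g) ∈ F.selmerGroup (p : ℤ) := by
    have h := hs'
    rw [kummerMapTorsion_apply] at h
    exact h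
  -- (4) the assembly of file XXXV with `A := F`: enlarge `T₁` by the kind-(i) places
  set T' := T₁ ∪ S₁.filter (fun v ↦ (p : 𝓞 ℚ) ∉ v.asIdeal ∧ Nat.card (nsmulAddMonoidHom p :
      (W.baseChange (v.adicCompletion ℚ)).toAffine.Point →+ _).ker = 1 ∧ v ≠ v₀) with hT'
  have hT'S : T' ⊆ S₁ := Finset.union_subset hTS₁ (Finset.filter_subset _ _)
  have hv₀T' : v₀ ∉ T' := by
    rw [hT', Finset.mem_union, Finset.mem_filter, not_or]
    exact ⟨hv₀T, fun h ↦ h.2.2.2 rfl⟩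
  have hle := natCard_selmerGroup_le_of_congr_of_le_off_insert_strict F W hp2 θ hθ S₁ T' hv₀S
    hv₀T' hT'S hS₁ (fun v hv hvT hvv₀ c hc ↦ ?_)
    (relIndex_map_selmerLocalKer_le_of_tateLine W F p hEP₀ hpv₀ hn θ hθ Φ' hequiv' hrat'
      (units_map_eq_self_of_pow_eq_one_of_dvd p hpv₀ hq) hpt)
    (fun c hc hsel ↦ h1Equiv_eq_zero_of_selmer_of_tateLine_certificate F v₀ W hn θ hθ Φ'
      hequiv' hrat' hSel (zsmul_zsmulRoot_mem F (p : ℤ) hdiv g) hs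
      (fun c' hc' ↦ hcert c' (by rw [hc', zsmul_zsmulRoot])) hc hsel)
  · refine bsdp_of_natCard_selmerGroup_le W p hGZK hCT hr hirr hSha (le_trans hle ?_)
    refine le_trans (le_of_eq ?_) hbudget₁
    congr 1
    have hsplit' : T' = T₁ ∪ (S₁.filter (fun v ↦ (p : 𝓞 ℚ) ∉ v.asIdeal ∧
        Nat.card (nsmulAddMonoidHom p :
          (W.baseChange (v.adicCompletion ℚ)).toAffine.Point →+ _).ker = 1 ∧ v ≠ v₀) \ T₁) := by
      rw [hT', Finset.union_sdiff_self_eq_union]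
    rw [hsplit', Finset.prod_union Finset.disjoint_sdiff,
      Finset.prod_eq_one (s := _ \ T₁) (fun v hv ↦ ?_), mul_one]
    · refine Finset.prod_congr rfl fun v _ ↦ ?_
      exact W.natCard_kummerLocalConditionAt_adicCompletion v hpp.ne_zero
    · rw [Finset.mem_sdiff, Finset.mem_filter] at hv
      rw [W.natCard_kummerLocalConditionAt_adicCompletion v hpp.ne_zero, hv.1.2.2.1, one_mul,
        natCard_quot_adicCompletionIntegers_eq_one hv.1.2.1]
  · have hvT0 : v ∉ T₁ := fun h ↦ hvT (Finset.mem_union_left _ h)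
    rcases hagree₁ v hv hvT0 hvv₀ with h1 | h2
    · exact absurd (Finset.mem_union_right _ (Finset.mem_filter.mpr ⟨hv, h1.1, h1.2, hvv₀⟩)) hvT
    · exact h2 c hc

end Summit.BirchSwinnertonDyer.Rank1Residual.X11a.SelmerCompanion

end
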